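import Summits.ValiantsHypothesis.ValiantsHypothesis.Theorems.LacunarySymmetroidMatrixDescartesCensusPivotConvexity

/-!
# `MatrixDescartes` census — pivot column: NO NSD ROOTS BELOW FULL INDEX (every size `m`), and at `m = 2`:
# every positive determinant root of an index-`≤ 1` pivot pencil is a PSD root

HONEST FRAMING.  Object-search cell `pub-symmetroid`, Conjecture-B column in PIVOT currency (`…CensusPivotDefs.lean`, seat conjb-1),
seat `val-sym-mdr-p1` (generation 6).  Helper file landed `--supports` the crux item stmt-ValiantsHypothesis-18050
(`Theses.LacunarySymmetroid.MatrixDescartes`, OPEN, on HOLD) with NO closure claim.  Sequel of the LOEWNER-CONVEXITY LAW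
(`…CensusPivotConvexity.lean`: at most TWO positive determinant roots carry `F(t) ⪯ 0`); here the index enters:

* **NO NSD ROOTS BELOW FULL INDEX** (`not_negSemidef_of_index_lt`, every `m`, every `K`, every exponents): if `J + W Wᵀ ⪰ 0` for a
  real `m × q` matrix `W` with `q < m` (pivot index `< m`) and `det F ≢ 0`, then NO `t > 0` has `F(t) ⪯ 0` — in particular no positive
  determinant root is an NSD root.  Proof: pick `u ≠ 0` with `Wᵀu = 0` (`q < m`); then `uᵀJu = uᵀ(J + WWᵀ)u ≥ 0`, so
  `uᵀF(t)u = t^e uᵀJu + ∑ t^{dₖ} uᵀPₖu ≥ 0`; `F(t) ⪯ 0` forces every term to vanish, hence `Pₖu = 0`, `(J + WWᵀ)u = 0`, `Ju = 0`,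
  `F(X)u ≡ 0` and `det F(X) = 0`.
* **`m = 2`, INDEX `≤ 1`: EVERY POSITIVE ROOT IS A PSD ROOT** (`posSemidef_at_posRoot_of_index_lt_two`): a singular symmetric `2 × 2`
  matrix is semidefinite (`Convexity.posSemidef_or_negSemidef_of_det_eq_zero`), and the NSD alternative is excluded; consequently
  **`pivotPosRoots e d J P = #{t > 0 : det F(t) = 0, F(t) ⪰ 0}`** (`pivotPosRoots_eq_card_posSemidef_of_index_lt_two`) — the `+ 2` of
  `Convexity.pivotPosRoots_le_two_add_card_posSemidef` drops for the index-1 column (conjb-1's `RankOnePivotLaw*` rows): every root of an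
  index-1 `2 × 2` pivot pencil is a PSD-boundary point of the Loewner-convex curve `u ↦ F(u)/u^e`, and at every root ALL quadratic forms
  of `F` are `≥ 0` (the roots avoid every negativity window `{u : vᵀF(u)v < 0}`, each an interval by the convexity law).
Nothing here bears on `Theses.LacunarySymmetroid.MatrixDescartes` in its window, on `KPlusLogSqLaw`, on `DoorA26` / `DoorA34`, on the
cell's registers or credences, or on `VP ≠ VNP`.

[folklore] Elementary linear algebra (rank–nullity `LinearMap.ker_ne_bot_of_finrank_lt`, `Matrix.PosSemidef` API,
`Matrix.exists_mulVec_eq_zero_iff` over `ℝ[X]`); tree `Pivot.eval_det_pivot`, `Pivot.Convexity.*`.  No definitions, no named facts.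
-/

-- `Summit.ValiantsHypothesis.ValiantsHypothesis.…` repeats a component by the D-0017 layout
-- (single-conjunct summit), which the `dupNamespace` linter flags; the name is mandated.
set_option linter.dupNamespace false

namespace Summit.ValiantsHypothesis.ValiantsHypothesis.Theorems.LacunarySymmetroidMatrixDescartes.Pivot.IndexRoots

open Matrix Finset Polynomial
open scoped BigOperators

variable {m K q : ℕ}

/-- Below full index there is a non-zero vector orthogonal to the columns of `W`. [folklore] -/
theorem exists_ne_zero_transpose_mulVec_eq_zero (W : Matrix (Fin m) (Fin q) ℝ) (hq : q < m) :
    ∃ u : Fin m → ℝ, u ≠ 0 ∧ Wᵀ *ᵥ u = 0 := by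
  have h : LinearMap.ker (Wᵀ.mulVecLin) ≠ ⊥ := by
    refine LinearMap.ker_ne_bot_of_finrank_lt ?_
    simpa using hq
  obtain ⟨u, hu, hu0⟩ := Submodule.exists_mem_ne_zero_of_ne_bot h
  refine ⟨u, hu0, ?_⟩
  rw [Matrix.mulVec_transpose]
  simpa using hu

/-- For `u` orthogonal to the columns of `W`, the index certificate `J + W Wᵀ ⪰ 0` gives `uᵀJu ≥ 0`. [folklore] -/
theorem quadForm_nonneg_of_orth {J : Matrix (Fin m) (Fin m) ℝ} {W : Matrix (Fin m) (Fin q) ℝ}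
    (hW : (J + W * Wᵀ).PosSemidef) {u : Fin m → ℝ} (hu : Wᵀ *ᵥ u = 0) : 0 ≤ u ⬝ᵥ (J *ᵥ u) := by
  have h := hW.dotProduct_mulVec_nonneg u
  rwa [star_trivial, Matrix.add_mulVec, dotProduct_add, ← Matrix.mulVec_mulVec, hu, Matrix.mulVec_zero,
    dotProduct_zero, add_zero] at h

/-- For `u` orthogonal to the columns of `W` with `uᵀJu = 0`, the certificate gives `Ju = 0`. [folklore] -/
theorem mulVec_eq_zero_of_orth {J : Matrix (Fin m) (Fin m) ℝ} {W : Matrix (Fin m) (Fin q) ℝ}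
    (hW : (J + W * Wᵀ).PosSemidef) {u : Fin m → ℝ} (hu : Wᵀ *ᵥ u = 0) (h0 : u ⬝ᵥ (J *ᵥ u) = 0) : J *ᵥ u = 0 := by
  have hq : star u ⬝ᵥ ((J + W * Wᵀ) *ᵥ u) = 0 := by
    rw [star_trivial, Matrix.add_mulVec, dotProduct_add, ← Matrix.mulVec_mulVec, hu, Matrix.mulVec_zero,
      dotProduct_zero, add_zero, h0]
  have h := (hW.dotProduct_mulVec_zero_iff u).1 hq
  rwa [Matrix.add_mulVec, ← Matrix.mulVec_mulVec, hu, Matrix.mulVec_zero, add_zero] at h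

/-- A common kernel vector of all letters kills the determinant of the pencil. [folklore] -/
theorem det_pencil_eq_zero_of_common_kernel (e : ℕ) (d : Fin K → ℕ) (J : Matrix (Fin m) (Fin m) ℝ)
    (P : Fin K → Matrix (Fin m) (Fin m) ℝ) {u : Fin m → ℝ} (hu0 : u ≠ 0) (hJ : J *ᵥ u = 0) (hP : ∀ k, P k *ᵥ u = 0) :
    Matrix.det (((X : ℝ[X]) ^ e) • J.map Polynomial.C + ∑ k, ((X : ℝ[X]) ^ d k) • (P k).map Polynomial.C) = 0 := by
  classical
  set w : Fin m → ℝ[X] := Polynomial.C ∘ u with hw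
  have hw0 : w ≠ 0 := fun h => hu0 (funext fun j => by simpa [hw] using congr_fun h j)
  have hmap : ∀ M : Matrix (Fin m) (Fin m) ℝ, M *ᵥ u = 0 → M.map Polynomial.C *ᵥ w = 0 := by
    intro M hM
    funext i
    have h := RingHom.map_mulVec Polynomial.C M u i
    rw [hM] at h
    simpa [hw] using h.symm
  refine Matrix.exists_mulVec_eq_zero_iff.mp ⟨w, hw0, ?_⟩
  rw [Matrix.add_mulVec, Matrix.smul_mulVec, hmap J hJ, smul_zero, zero_add, Matrix.sum_mulVec]
  exact Finset.sum_eq_zero fun k _ => by rw [Matrix.smul_mulVec, hmap (P k) (hP k), smul_zero]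

/-- **NO NSD VALUES BELOW FULL INDEX** (every size `m`, every `K`).  If `J + W Wᵀ ⪰ 0` for an `m × q` matrix `W` with `q < m`,
the letters `Pₖ` are PSD and `det F ≢ 0`, then `F(t) = t^e J + ∑ t^{dₖ} Pₖ` is NOT negative semidefinite at any `t > 0`. [folklore] -/
theorem not_negSemidef_of_index_lt (e : ℕ) (d : Fin K → ℕ) (J : Matrix (Fin m) (Fin m) ℝ)
    (P : Fin K → Matrix (Fin m) (Fin m) ℝ) (hP : ∀ k, (P k).PosSemidef) (W : Matrix (Fin m) (Fin q) ℝ) (hq : q < m)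
    (hW : (J + W * Wᵀ).PosSemidef)
    (hdet : Matrix.det (((X : ℝ[X]) ^ e) • J.map Polynomial.C + ∑ k, ((X : ℝ[X]) ^ d k) • (P k).map Polynomial.C) ≠ 0)
    {t : ℝ} (ht : 0 < t) : ¬ (-(t ^ e • J + ∑ k, t ^ d k • P k)).PosSemidef := by
  intro hN
  obtain ⟨u, hu0, hu⟩ := exists_ne_zero_transpose_mulVec_eq_zero W hq
  have hJu : 0 ≤ u ⬝ᵥ (J *ᵥ u) := quadForm_nonneg_of_orth hW hu
  have hPu : ∀ k, 0 ≤ u ⬝ᵥ (P k *ᵥ u) := fun k => by simpa only [star_trivial] using (hP k).dotProduct_mulVec_nonneg u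
  -- the form of `u` at `t` is `≤ 0` (NSD) and a sum of non-negative terms
  have hle : u ⬝ᵥ ((t ^ e • J + ∑ k, t ^ d k • P k) *ᵥ u) ≤ 0 := by
    have h := hN.dotProduct_mulVec_nonneg u
    simp only [star_trivial, Matrix.neg_mulVec, dotProduct_neg, neg_nonneg] at h
    exact h
  rw [Convexity.quadForm_eval_pencil] at hle
  have hte : 0 < t ^ e := pow_pos ht _
  have hterm : ∀ k, 0 ≤ t ^ d k * (u ⬝ᵥ (P k *ᵥ u)) := fun k => mul_nonneg (pow_pos ht _).le (hPu k)
  have hsum : 0 ≤ ∑ k, t ^ d k * (u ⬝ᵥ (P k *ᵥ u)) := Finset.sum_nonneg fun k _ => hterm k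
  have hJ0 : u ⬝ᵥ (J *ᵥ u) = 0 := by nlinarith [mul_nonneg hte.le hJu]
  have hS0 : ∑ k, t ^ d k * (u ⬝ᵥ (P k *ᵥ u)) = 0 := by nlinarith [mul_nonneg hte.le hJu]
  have hPk : ∀ k, P k *ᵥ u = 0 := by
    intro k
    have hk : t ^ d k * (u ⬝ᵥ (P k *ᵥ u)) = 0 :=
      (Finset.sum_eq_zero_iff_of_nonneg (fun k _ => hterm k)).1 hS0 k (Finset.mem_univ k)
    have hk' : u ⬝ᵥ (P k *ᵥ u) = 0 := (mul_eq_zero.mp hk).resolve_left (pow_ne_zero _ ht.ne')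
    exact ((hP k).dotProduct_mulVec_zero_iff u).1 (by rw [star_trivial]; exact hk')
  exact hdet (det_pencil_eq_zero_of_common_kernel e d J P hu0 (mulVec_eq_zero_of_orth hW hu hJ0) hPk)

/-- **`m = 2`, index `≤ 1`: every positive determinant root is a PSD root.**  For a `2 × 2` pivot pencil with `J` symmetric,
`Pₖ ⪰ 0` and `J + W Wᵀ ⪰ 0` for a `2 × q` matrix `W` with `q < 2`, every positive root `t` of `det F` has `F(t) ⪰ 0`. [folklore] -/
theorem posSemidef_at_posRoot_of_index_lt_two (e : ℕ) (d : Fin K → ℕ) (J : Matrix (Fin 2) (Fin 2) ℝ)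
    (P : Fin K → Matrix (Fin 2) (Fin 2) ℝ) (hJ : J.IsSymm) (hP : ∀ k, (P k).PosSemidef) (W : Matrix (Fin 2) (Fin q) ℝ)
    (hq : q < 2) (hW : (J + W * Wᵀ).PosSemidef) {t : ℝ} (ht : 0 < t)
    (hroot : t ∈ (Matrix.det (((X : ℝ[X]) ^ e) • J.map Polynomial.C
        + ∑ k, ((X : ℝ[X]) ^ d k) • (P k).map Polynomial.C)).roots) :
    (t ^ e • J + ∑ k, t ^ d k • P k).PosSemidef := by
  classical
  set Fp := Matrix.det (((X : ℝ[X]) ^ e) • J.map Polynomial.C + ∑ k, ((X : ℝ[X]) ^ d k) • (P k).map Polynomial.C)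
    with hFp
  have hdet : Fp ≠ 0 := fun h => by rw [h, Polynomial.roots_zero] at hroot; exact absurd hroot (by simp)
  have hdt : (t ^ e • J + ∑ k, t ^ d k • P k).det = 0 := by
    have h := (Polynomial.mem_roots hdet).1 hroot
    rwa [Polynomial.IsRoot.def, hFp, eval_det_pivot] at h
  have hsymm : (t ^ e • J + ∑ k, t ^ d k • P k).IsSymm :=
    Matrix.isHermitian_iff_isSymm.1 (Convexity.isHermitian_eval_pencil e d J P hJ hP t)
  rcases Convexity.posSemidef_or_negSemidef_of_det_eq_zero hsymm hdt with h | h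
  · exact h
  · exact absurd h (not_negSemidef_of_index_lt e d J P hP W hq hW hdet ht)

open scoped Classical in
/-- **The index-1 column counts PSD roots only** (`m = 2`): under the hypotheses of `posSemidef_at_posRoot_of_index_lt_two`,
`pivotPosRoots e d J P` equals the number of distinct positive roots `t` of `det F` with `F(t) ⪰ 0`. [folklore] -/
theorem pivotPosRoots_eq_card_posSemidef_of_index_lt_two (e : ℕ) (d : Fin K → ℕ) (J : Matrix (Fin 2) (Fin 2) ℝ)
    (P : Fin K → Matrix (Fin 2) (Fin 2) ℝ) (hJ : J.IsSymm) (hP : ∀ k, (P k).PosSemidef) (W : Matrix (Fin 2) (Fin q) ℝ)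
    (hq : q < 2) (hW : (J + W * Wᵀ).PosSemidef) :
    pivotPosRoots e d J P =
      ((Matrix.det (((X : ℝ[X]) ^ e) • J.map Polynomial.C
        + ∑ k, ((X : ℝ[X]) ^ d k) • (P k).map Polynomial.C)).roots.toFinset.filter
        (fun t => 0 < t ∧ (t ^ e • J + ∑ k, t ^ d k • P k).PosSemidef)).card := by
  unfold pivotPosRoots
  congr 1
  ext t
  simp only [Finset.mem_filter, Multiset.mem_toFinset]
  constructor
  · rintro ⟨hr, ht⟩
    exact ⟨hr, ht, posSemidef_at_posRoot_of_index_lt_two e d J P hJ hP W hq hW ht hr⟩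
  · rintro ⟨hr, ht, -⟩
    exact ⟨hr, ht⟩

/-- **At a root of an index-`≤ 1` `2 × 2` pivot pencil every quadratic form is non-negative**: the positive roots avoid every
negativity window `{u : vᵀF(u)v < 0}` (each an interval by the convexity law). [folklore] -/
theorem quadForm_nonneg_at_posRoot_of_index_lt_two (e : ℕ) (d : Fin K → ℕ) (J : Matrix (Fin 2) (Fin 2) ℝ)
    (P : Fin K → Matrix (Fin 2) (Fin 2) ℝ) (hJ : J.IsSymm) (hP : ∀ k, (P k).PosSemidef) (W : Matrix (Fin 2) (Fin q) ℝ)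
    (hq : q < 2) (hW : (J + W * Wᵀ).PosSemidef) {t : ℝ} (ht : 0 < t)
    (hroot : t ∈ (Matrix.det (((X : ℝ[X]) ^ e) • J.map Polynomial.C
        + ∑ k, ((X : ℝ[X]) ^ d k) • (P k).map Polynomial.C)).roots) (v : Fin 2 → ℝ) :
    0 ≤ v ⬝ᵥ ((t ^ e • J + ∑ k, t ^ d k • P k) *ᵥ v) := by
  simpa only [star_trivial] using
    (posSemidef_at_posRoot_of_index_lt_two e d J P hJ hP W hq hW ht hroot).dotProduct_mulVec_nonneg v

end Summit.ValiantsHypothesis.ValiantsHypothesis.Theorems.LacunarySymmetroidMatrixDescartes.Pivot.IndexRoots
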